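import Literature.Geometry.Lorentzian.GowdyRicciAlgebra
import Literature.Geometry.Lorentzian.DiagonalChartMetric
import Mathlib.Analysis.SpecialFunctions.ExpDeriv
import Mathlib.Analysis.SpecialFunctions.Log.Deriv
import Mathlib.Analysis.Calculus.FDeriv.Symmetric
import HarnessLib

/-!
# Polarized Gowdy metrics are vacuum: `Ric = 0` from the Euler–Poisson–Darboux system

Support file (everything proved, no named facts) for the explicit vacuum spacetime of
`Literature.Geometry.Lorentzian.christodoulou_trapped_surface_formation_holds`.

On an open set `V ⊆ {y : E4 | 0 < y⁰}` let `P, λ : E4 → ℝ` be smooth functions of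
`(t, θ) = (y⁰, y¹)` alone (`∂₂ = ∂₃ = 0`) satisfying the **polarized Gowdy equations**
`P_tt + P_t/t = P_θθ`, `λ_t = t (P_t² + P_θ²)`, `λ_θ = 2 t P_t P_θ` (`Gowdy.GowdyData`). Then the
metric `g = t^{-1/2} e^{λ/2} (−dt² + dθ²) + t e^{P} dξ² + t e^{−P} dζ²`, i.e. the diagonal
components `(−e^{a}, e^{a}, e^{b}, e^{c})` with `a = −½ log t + λ/2`, `b = log t + P`,
`c = log t − P` (`Gowdy.comp`), has vanishing coordinate Ricci form (`Gowdy.ricAt_comp_eq_zero`),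
hence the Lorentzian metric it defines on `V : Opens E4` (`DiagonalChartMetric.lean`) is
Ricci-flat (`Gowdy.isRicciFlat`). Gowdy 1974, §II; Isenberg–Moncrief 1990, (3)–(5);
Ringström 2009, §24.1. The proof computes the first and second partials of the components
(chain rule through `exp`, `log`) and feeds them to the algebraic identity `Gowdy.ricci_core`
(`GowdyRicciAlgebra.lean`).

## References

* R. H. Gowdy, Ann. Phys. 83 (1974) 203–241, §II.
* J. Isenberg, V. Moncrief, Ann. Phys. 199 (1990) 84–122, (3)–(5).
* H. Ringström, *The Cauchy Problem in General Relativity*, EMS 2009, §24.1.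
* B. O'Neill, *Semi-Riemannian geometry*, 1983, Ch. 3, Lemma 3.52. [ONeill1983]
-/

noncomputable section

set_option maxSynthPendingDepth 3

open Set Filter TopologicalSpace
open scoped Topology ContDiff Manifold

namespace Literature.Geometry.Lorentzian

namespace Gowdy

open MetricCoord

/-! ### Calculus on `E4`: coordinate functions, `log`, `exp`, second partials -/

/-- The coordinate function `y ↦ y⁰` has derivative `dy⁰`. [folklore] -/
theorem hasFDerivAt_coord (μ : Fin 4) (y : E4) :
    HasFDerivAt (fun z : E4 ↦ z μ) (EuclideanSpace.proj μ : E4 →L[ℝ] ℝ) y :=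
  (EuclideanSpace.proj μ : E4 →L[ℝ] ℝ).hasFDerivAt

/-- `∂_v log y⁰ = v⁰ / y⁰`. [folklore] -/
theorem hasFDerivAt_log_coord {y : E4} (hy : y 0 ≠ 0) :
    HasFDerivAt (fun z : E4 ↦ Real.log (z 0)) ((y 0)⁻¹ • (EuclideanSpace.proj 0 : E4 →L[ℝ] ℝ)) y := by
  have h1 : HasDerivAt Real.log (y 0)⁻¹ (y 0) := Real.hasDerivAt_log hy
  exact h1.comp_hasFDerivAt y (hasFDerivAt_coord 0 y)

/-- `y ↦ log y⁰` is smooth on `{y⁰ ≠ 0}`-points. [folklore] -/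
theorem contDiffAt_log_coord {y : E4} (hy : y 0 ≠ 0) {n : ℕ∞ω} :
    ContDiffAt ℝ n (fun z : E4 ↦ Real.log (z 0)) y := by
  have h1 : ContDiffAt ℝ n Real.log (y 0) := Real.contDiffAt_log.mpr hy
  have h2 : ContDiffAt ℝ n (fun z : E4 ↦ z 0) y :=
    (EuclideanSpace.proj (0 : Fin 4) : E4 →L[ℝ] ℝ).contDiff.contDiffAt
  exact h1.comp y h2

/-- `∂_w (v⁰ / y⁰) = − v⁰ w⁰ / (y⁰)²`. [folklore] -/
theorem hasFDerivAt_const_div_coord {y : E4} (hy : y 0 ≠ 0) (c : ℝ) :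
    HasFDerivAt (fun z : E4 ↦ c / z 0)
      ((-(c / (y 0) ^ 2)) • (EuclideanSpace.proj 0 : E4 →L[ℝ] ℝ)) y := by
  have h1 : HasDerivAt (fun x : ℝ ↦ c / x) (-(c / (y 0) ^ 2)) (y 0) := by
    simpa [div_eq_mul_inv] using (hasDerivAt_inv hy).const_mul c
  exact h1.comp_hasFDerivAt y (hasFDerivAt_coord 0 y)

/-- **Symmetry of second coordinate partials** of a `C²` function:
`∂_w (∂_v f) = ∂_v (∂_w f)`. [folklore] -/
theorem fderiv_fderiv_comm {f : E4 → ℝ} {y : E4} {n : ℕ∞ω} (hf : ContDiffAt ℝ n f y)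
    (hn : 2 ≤ n) (v w : E4) :
    fderiv ℝ (fun z ↦ fderiv ℝ f z v) y w = fderiv ℝ (fun z ↦ fderiv ℝ f z w) y v := by
  have hd : DifferentiableAt ℝ (fderiv ℝ f) y := by
    have h2 : ContDiffAt ℝ 2 f y := hf.of_le hn
    exact (h2.fderiv_right (m := 1) (by norm_num)).differentiableAt one_ne_zero
  rw [fderiv_clm_apply_const hd v w, fderiv_clm_apply_const hd w v]
  have hs := hf.isSymmSndFDerivAt (n := n) (by
    rw [minSmoothness_of_isRCLikeNormedField]; exact_mod_cast hn)
  exact hs w v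

/-- If `z ↦ ∂_v f (z)` vanishes near `y` then `∂_w ∂_v f (y) = 0`. [folklore] -/
theorem fderiv_fderiv_eq_zero_of_eventually {f : E4 → ℝ} {y : E4} {v : E4}
    (h : ∀ᶠ z in 𝓝 y, fderiv ℝ f z v = 0) (w : E4) :
    fderiv ℝ (fun z ↦ fderiv ℝ f z v) y w = 0 := by
  have : (fun z ↦ fderiv ℝ f z v) =ᶠ[𝓝 y] fun _ ↦ (0 : ℝ) := h
  rw [this.fderiv_eq]
  simp

/-- **First derivative of `s · exp ∘ u`**: `∂_v (s e^{u}) = s e^{u} ∂_v u`. [folklore] -/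
theorem fderiv_const_mul_exp {u : E4 → ℝ} {y : E4} (hu : DifferentiableAt ℝ u y) (s : ℝ)
    (v : E4) :
    fderiv ℝ (fun z ↦ s * Real.exp (u z)) y v = s * Real.exp (u y) * fderiv ℝ u y v := by
  have h : HasFDerivAt (fun z ↦ s * Real.exp (u z))
      (s • (Real.exp (u y) • fderiv ℝ u y)) y :=
    ((Real.hasDerivAt_exp (u y)).comp_hasFDerivAt y hu.hasFDerivAt).const_mul s
  rw [h.fderiv]
  simp [smul_eq_mul, mul_assoc]

/-- **Second derivatives of `s · exp ∘ u`** at a point where `u` is `C²`: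
`∂_w ∂_v (s e^{u}) = s e^{u} (∂_w u ∂_v u + ∂_w ∂_v u)`. [folklore] -/
theorem fderiv_fderiv_const_mul_exp {u : E4 → ℝ} {y : E4} {U : Set E4} (hU : IsOpen U)
    (hy : y ∈ U) (hu : ContDiffOn ℝ ∞ u U) (s : ℝ) (v w : E4) :
    fderiv ℝ (fun z ↦ fderiv ℝ (fun x ↦ s * Real.exp (u x)) z v) y w =
      s * Real.exp (u y) * (fderiv ℝ u y w * fderiv ℝ u y v + fderiv ℝ (fun z ↦ fderiv ℝ u z v) y w) := by
  have hdiff : ∀ z ∈ U, DifferentiableAt ℝ u z := fun z hz ↦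
    (hu.contDiffAt (hU.mem_nhds hz)).differentiableAt (by simp)
  have heq : (fun z ↦ fderiv ℝ (fun x ↦ s * Real.exp (u x)) z v) =ᶠ[𝓝 y]
      fun z ↦ s * Real.exp (u z) * fderiv ℝ u z v := by
    filter_upwards [hU.mem_nhds hy] with z hz
    exact fderiv_const_mul_exp (hdiff z hz) s v
  rw [heq.fderiv_eq]
  have h1 : DifferentiableAt ℝ (fun z ↦ s * Real.exp (u z)) y :=
    ((hdiff y hy).exp).const_mul s
  have h2 : DifferentiableAt ℝ (fun z ↦ fderiv ℝ u z v) y := by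
    have hc : ContDiffAt ℝ ∞ (fderiv ℝ u) y :=
      ((hu.fderiv_of_isOpen hU (by simp)) y hy).contDiffAt (hU.mem_nhds hy)
    exact differentiableAt_clm_apply_const (hc.differentiableAt (by simp)) v
  rw [fderiv_fun_mul h1 h2]
  simp only [_root_.add_apply, FunLike.coe_smul, Pi.smul_apply, smul_eq_mul]
  rw [fderiv_const_mul_exp (hdiff y hy) s w]
  ring

/-! ### The Gowdy data -/

/-- **Polarized Gowdy data** on an open set `V ⊆ {t > 0}` of `E4` (coordinates
`(t, θ, ξ, ζ) = (y⁰, y¹, y², y³)`): smooth functions `P, λ` of `(t, θ)` alone satisfying the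
Euler–Poisson–Darboux equation `P_tt + P_t/t = P_θθ` and the constraint/quadrature equations
`λ_t = t (P_t² + P_θ²)`, `λ_θ = 2 t P_t P_θ`. Gowdy 1974, §II; Isenberg–Moncrief 1990,
(4)–(5) (polarized case `Q = 0`); Ringström 2009, §24.1. [cite: IsenbergMoncrief1990, (4)–(5)] -/
structure GowdyData (V : Set E4) (P L : E4 → ℝ) : Prop where
  isOpen : IsOpen V
  pos : ∀ y ∈ V, 0 < y 0
  contDiffOn_P : ContDiffOn ℝ ∞ P V
  contDiffOn_L : ContDiffOn ℝ ∞ L V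
  P_two : ∀ y ∈ V, fderiv ℝ P y (eb 2) = 0
  P_three : ∀ y ∈ V, fderiv ℝ P y (eb 3) = 0
  L_two : ∀ y ∈ V, fderiv ℝ L y (eb 2) = 0
  L_three : ∀ y ∈ V, fderiv ℝ L y (eb 3) = 0
  epd : ∀ y ∈ V, fderiv ℝ (fun z ↦ fderiv ℝ P z (eb 0)) y (eb 0) + fderiv ℝ P y (eb 0) / y 0 =
    fderiv ℝ (fun z ↦ fderiv ℝ P z (eb 1)) y (eb 1)
  lam_t : ∀ y ∈ V, fderiv ℝ L y (eb 0) =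
    y 0 * (fderiv ℝ P y (eb 0) ^ 2 + fderiv ℝ P y (eb 1) ^ 2)
  lam_θ : ∀ y ∈ V, fderiv ℝ L y (eb 1) = 2 * y 0 * fderiv ℝ P y (eb 0) * fderiv ℝ P y (eb 1)

/-- The logarithm `a = −½ log t + λ/2` of the conformal factor `A = t^{-1/2} e^{λ/2}` of the
`(t, θ)`-block. [cite: IsenbergMoncrief1990, (3)] -/
def aF (L : E4 → ℝ) (y : E4) : ℝ := -(1 / 2) * Real.log (y 0) + L y / 2

/-- The logarithm `b = log t + P` of `B = t e^{P} = g(∂_ξ, ∂_ξ)`. [cite: IsenbergMoncrief1990, (3)] -/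
def bF (P : E4 → ℝ) (y : E4) : ℝ := Real.log (y 0) + P y

/-- The logarithm `c = log t − P` of `C = t e^{−P} = g(∂_ζ, ∂_ζ)`. [cite: IsenbergMoncrief1990, (3)] -/
def cF (P : E4 → ℝ) (y : E4) : ℝ := Real.log (y 0) - P y

/-- The logarithms `u = (a, a, b, c)` of the absolute values of the diagonal components.
[cite: IsenbergMoncrief1990, (3)] -/
def uF (P L : E4 → ℝ) : Fin 4 → E4 → ℝ := ![aF L, aF L, bF P, cF P]

/-- The signs `(−1, 1, 1, 1)` of the components. [folklore] -/
def sgn : Fin 4 → ℝ := ![-1, 1, 1, 1]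

/-- **The polarized Gowdy metric components** in the coordinates `(t, θ, ξ, ζ)`:
`(g₀, g₁, g₂, g₃) = (−t^{-1/2}e^{λ/2}, t^{-1/2}e^{λ/2}, t e^{P}, t e^{−P}) = (sgnᵢ e^{uᵢ})`.
Isenberg–Moncrief 1990, (3) with `Q = 0`. [cite: IsenbergMoncrief1990, (3)] -/
def comp (P L : E4 → ℝ) (i : Fin 4) (y : E4) : ℝ := sgn i * Real.exp (uF P L i y)

variable {V : Set E4} {P L : E4 → ℝ}

/-- `a` is smooth on `V`. [folklore] -/
theorem contDiffOn_aF (h : GowdyData V P L) : ContDiffOn ℝ ∞ (aF L) V := by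
  intro y hy
  have h1 : ContDiffAt ℝ ∞ (fun z : E4 ↦ Real.log (z 0)) y :=
    contDiffAt_log_coord (h.pos y hy).ne'
  exact ((h1.const_smul (-(1 / 2) : ℝ)).contDiffWithinAt.add
    ((h.contDiffOn_L y hy).div_const 2)).congr (fun z _ ↦ by simp [aF, smul_eq_mul])
      (by simp [aF, smul_eq_mul])

/-- `b` is smooth on `V`. [folklore] -/
theorem contDiffOn_bF (h : GowdyData V P L) : ContDiffOn ℝ ∞ (bF P) V := by
  intro y hy
  have h1 : ContDiffAt ℝ ∞ (fun z : E4 ↦ Real.log (z 0)) y :=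
    contDiffAt_log_coord (h.pos y hy).ne'
  exact h1.contDiffWithinAt.add (h.contDiffOn_P y hy)

/-- `c` is smooth on `V`. [folklore] -/
theorem contDiffOn_cF (h : GowdyData V P L) : ContDiffOn ℝ ∞ (cF P) V := by
  intro y hy
  have h1 : ContDiffAt ℝ ∞ (fun z : E4 ↦ Real.log (z 0)) y :=
    contDiffAt_log_coord (h.pos y hy).ne'
  exact h1.contDiffWithinAt.sub (h.contDiffOn_P y hy)

/-- Every `uᵢ` is smooth on `V`. [folklore] -/
theorem contDiffOn_uF (h : GowdyData V P L) (i : Fin 4) : ContDiffOn ℝ ∞ (uF P L i) V := by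
  fin_cases i
  · exact contDiffOn_aF h
  · exact contDiffOn_aF h
  · exact contDiffOn_bF h
  · exact contDiffOn_cF h

/-- **The Gowdy components are smooth on `V`.** [cite: IsenbergMoncrief1990, (3)] -/
theorem contDiffOn_comp (h : GowdyData V P L) (i : Fin 4) : ContDiffOn ℝ ∞ (comp P L i) V :=
  ((contDiffOn_uF h i).exp).const_smul (sgn i) |>.congr (fun y _ ↦ by simp [comp, smul_eq_mul])

/-- The sign of the entries: `g₀ < 0`. [cite: IsenbergMoncrief1990, (3)] -/
theorem comp_zero_neg (y : E4) : comp P L 0 y < 0 := by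
  simp only [comp, sgn, uF, Matrix.cons_val_zero]
  have := Real.exp_pos (aF L y)
  linarith

/-- The sign of the entries: `g₁, g₂, g₃ > 0`. [cite: IsenbergMoncrief1990, (3)] -/
theorem comp_succ_pos (i : Fin 3) (y : E4) : 0 < comp P L i.succ y := by
  fin_cases i <;> simp [comp, sgn, uF, Real.exp_pos]

/-- The entries are nonzero. [folklore] -/
theorem comp_ne_zero (i : Fin 4) (y : E4) : comp P L i y ≠ 0 := by
  refine Fin.cases ?_ (fun j ↦ ?_) i
  · exact (comp_zero_neg y).ne
  · exact (comp_succ_pos j y).ne'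

/-! ### First partials -/

/-- `(e_β)⁰ = δ_{0β}` for the coordinate vectors of `E4`. [folklore] -/
theorem eb_zero_apply (β : Fin 4) : (eb β : E4) 0 = if (0 : Fin 4) = β then 1 else 0 :=
  eb_apply β 0

/-- **First derivative of `a`**: `∂_v a = −v⁰/(2t) + ∂_v λ / 2`. [cite: IsenbergMoncrief1990, (3)] -/
theorem fderiv_aF (h : GowdyData V P L) {y : E4} (hy : y ∈ V) (v : E4) :
    fderiv ℝ (aF L) y v = -(1 / 2) * (v 0 / y 0) + fderiv ℝ L y v / 2 := by
  have ht : y 0 ≠ 0 := (h.pos y hy).ne'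
  have hL : DifferentiableAt ℝ L y :=
    ((h.contDiffOn_L).contDiffAt (h.isOpen.mem_nhds hy)).differentiableAt (by simp)
  have hA : HasFDerivAt (aF L)
      ((-(1 / 2) : ℝ) • ((y 0)⁻¹ • (EuclideanSpace.proj 0 : E4 →L[ℝ] ℝ)) +
        (2 : ℝ)⁻¹ • fderiv ℝ L y) y := by
    have := ((hasFDerivAt_log_coord ht).const_mul (-(1 / 2) : ℝ)).add
      (hL.hasFDerivAt.mul_const' (2 : ℝ)⁻¹)
    -- massage `aF`
    refine HasFDerivAt.congr_fderiv (this.congr_of_eventuallyEq ?_) ?_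
    · exact Eventually.of_forall fun z ↦ by simp [aF, div_eq_mul_inv]
    · ext w
      simp [smul_eq_mul, mul_comm]
  rw [hA.fderiv]
  simp [smul_eq_mul, div_eq_mul_inv]
  ring

/-- **First derivative of `b`**: `∂_v b = v⁰/t + ∂_v P`. [cite: IsenbergMoncrief1990, (3)] -/
theorem fderiv_bF (h : GowdyData V P L) {y : E4} (hy : y ∈ V) (v : E4) :
    fderiv ℝ (bF P) y v = v 0 / y 0 + fderiv ℝ P y v := by
  have ht : y 0 ≠ 0 := (h.pos y hy).ne'
  have hP : DifferentiableAt ℝ P y :=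
    ((h.contDiffOn_P).contDiffAt (h.isOpen.mem_nhds hy)).differentiableAt (by simp)
  have hB : HasFDerivAt (bF P)
      ((y 0)⁻¹ • (EuclideanSpace.proj 0 : E4 →L[ℝ] ℝ) + fderiv ℝ P y) y :=
    (hasFDerivAt_log_coord ht).add hP.hasFDerivAt
  rw [hB.fderiv]
  simp [smul_eq_mul, div_eq_mul_inv, mul_comm]

/-- **First derivative of `c`**: `∂_v c = v⁰/t − ∂_v P`. [cite: IsenbergMoncrief1990, (3)] -/
theorem fderiv_cF (h : GowdyData V P L) {y : E4} (hy : y ∈ V) (v : E4) :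
    fderiv ℝ (cF P) y v = v 0 / y 0 - fderiv ℝ P y v := by
  have ht : y 0 ≠ 0 := (h.pos y hy).ne'
  have hP : DifferentiableAt ℝ P y :=
    ((h.contDiffOn_P).contDiffAt (h.isOpen.mem_nhds hy)).differentiableAt (by simp)
  have hC : HasFDerivAt (cF P)
      ((y 0)⁻¹ • (EuclideanSpace.proj 0 : E4 →L[ℝ] ℝ) - fderiv ℝ P y) y :=
    (hasFDerivAt_log_coord ht).sub hP.hasFDerivAt
  rw [hC.fderiv]
  simp [smul_eq_mul, div_eq_mul_inv, mul_comm]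

/-- **The table of first partials**: `∂_β uᵢ (y) = uFst …`, with `t = y⁰`, `P_t = ∂₀P`,
`P_θ = ∂₁P`. [cite: IsenbergMoncrief1990, (4)–(5)] -/
theorem fderiv_uF_eq (h : GowdyData V P L) {y : E4} (hy : y ∈ V) (i β : Fin 4) :
    fderiv ℝ (uF P L i) y (eb β) =
      uFst (y 0) (fderiv ℝ P y (eb 0)) (fderiv ℝ P y (eb 1)) i β := by
  have ht : y 0 ≠ 0 := (h.pos y hy).ne'
  fin_cases i <;> fin_cases β <;>
    simp [uF, uFst, fderiv_aF h hy, fderiv_bF h hy, fderiv_cF h hy,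
      h.lam_t y hy, h.lam_θ y hy, h.P_two y hy, h.P_three y hy, h.L_two y hy, h.L_three y hy,
      Lt, Lθ] <;>
    ring

/-- **First partials of the components**: `∂_β gᵢ = d1 …` (`= gᵢ ∂_β uᵢ`).
[cite: IsenbergMoncrief1990, (3)–(5)] -/
theorem fderiv_comp_eq (h : GowdyData V P L) {y : E4} (hy : y ∈ V) (i β : Fin 4) :
    fderiv ℝ (comp P L i) y (eb β) =
      d1 (y 0) (Real.exp (aF L y)) (Real.exp (bF P y)) (Real.exp (cF P y))
        (fderiv ℝ P y (eb 0)) (fderiv ℝ P y (eb 1)) i β := by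
  have hu : DifferentiableAt ℝ (uF P L i) y :=
    ((contDiffOn_uF h i).contDiffAt (h.isOpen.mem_nhds hy)).differentiableAt (by simp)
  have hc : comp P L i = fun z ↦ sgn i * Real.exp (uF P L i z) := rfl
  rw [hc, fderiv_const_mul_exp hu, fderiv_uF_eq h hy, d1]
  congr 1
  fin_cases i <;> simp [gval, sgn, uF]

/-! ### Second partials -/

/-- Mixed partials of `P` vanish whenever a `ξ`- or `ζ`-direction is involved. [folklore] -/
theorem fderiv_fderiv_P_eq_zero_right (h : GowdyData V P L) {y : E4} (hy : y ∈ V) (β : Fin 4)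
    (hβ : β = 2 ∨ β = 3) (w : E4) :
    fderiv ℝ (fun z ↦ fderiv ℝ P z (eb β)) y w = 0 := by
  apply fderiv_fderiv_eq_zero_of_eventually
  filter_upwards [h.isOpen.mem_nhds hy] with z hz
  rcases hβ with rfl | rfl
  · exact h.P_two z hz
  · exact h.P_three z hz

/-- Mixed partials of `λ` vanish whenever a `ξ`- or `ζ`-direction is involved. [folklore] -/
theorem fderiv_fderiv_L_eq_zero_right (h : GowdyData V P L) {y : E4} (hy : y ∈ V) (β : Fin 4)
    (hβ : β = 2 ∨ β = 3) (w : E4) :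
    fderiv ℝ (fun z ↦ fderiv ℝ L z (eb β)) y w = 0 := by
  apply fderiv_fderiv_eq_zero_of_eventually
  filter_upwards [h.isOpen.mem_nhds hy] with z hz
  rcases hβ with rfl | rfl
  · exact h.L_two z hz
  · exact h.L_three z hz

/-- Mixed partials of `P` vanish whenever a `ξ`- or `ζ`-direction is involved, in either slot
(symmetry of second derivatives). [folklore] -/
theorem fderiv_fderiv_P_eq_zero (h : GowdyData V P L) {y : E4} (hy : y ∈ V) (α β : Fin 4)
    (hαβ : (β = 2 ∨ β = 3) ∨ (α = 2 ∨ α = 3)) :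
    fderiv ℝ (fun z ↦ fderiv ℝ P z (eb β)) y (eb α) = 0 := by
  have hP : ContDiffAt ℝ ∞ P y := (h.contDiffOn_P).contDiffAt (h.isOpen.mem_nhds hy)
  rcases hαβ with hβ | hα
  · exact fderiv_fderiv_P_eq_zero_right h hy β hβ _
  · rw [fderiv_fderiv_comm hP (WithTop.coe_le_coe.mpr le_top)]
    exact fderiv_fderiv_P_eq_zero_right h hy α hα _

/-- The mixed partial `∂_θ ∂_t P = ∂_t ∂_θ P`. [folklore] -/
theorem fderiv_fderiv_P_comm (h : GowdyData V P L) {y : E4} (hy : y ∈ V) :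
    fderiv ℝ (fun z ↦ fderiv ℝ P z (eb 0)) y (eb 1) =
      fderiv ℝ (fun z ↦ fderiv ℝ P z (eb 1)) y (eb 0) := by
  have hP : ContDiffAt ℝ ∞ P y := (h.contDiffOn_P).contDiffAt (h.isOpen.mem_nhds hy)
  exact fderiv_fderiv_comm hP (WithTop.coe_le_coe.mpr le_top) _ _

/-- The `λ`-Hessian on coordinate vectors in terms of the `P`-jet (differentiate the Gowdy
equations `λ_t = t(P_t² + P_θ²)`, `λ_θ = 2tP_tP_θ` along `eₐ`). [cite: IsenbergMoncrief1990, (5)] -/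
theorem fderiv_fderiv_L_eq (h : GowdyData V P L) {y : E4} (hy : y ∈ V) (α β : Fin 4) :
    fderiv ℝ (fun z ↦ fderiv ℝ L z (eb β)) y (eb α) =
      ![![(eb α : E4) 0 * (fderiv ℝ P y (eb 0) ^ 2 + fderiv ℝ P y (eb 1) ^ 2)
            + y 0 * (2 * fderiv ℝ P y (eb 0) * fderiv ℝ (fun z ↦ fderiv ℝ P z (eb 0)) y (eb α)
              + 2 * fderiv ℝ P y (eb 1) * fderiv ℝ (fun z ↦ fderiv ℝ P z (eb 1)) y (eb α)),
          2 * (eb α : E4) 0 * fderiv ℝ P y (eb 0) * fderiv ℝ P y (eb 1)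
            + 2 * y 0 * (fderiv ℝ (fun z ↦ fderiv ℝ P z (eb 0)) y (eb α) * fderiv ℝ P y (eb 1)
              + fderiv ℝ P y (eb 0) * fderiv ℝ (fun z ↦ fderiv ℝ P z (eb 1)) y (eb α)),
          0, 0],
        ![(eb α : E4) 0 * (fderiv ℝ P y (eb 0) ^ 2 + fderiv ℝ P y (eb 1) ^ 2)
            + y 0 * (2 * fderiv ℝ P y (eb 0) * fderiv ℝ (fun z ↦ fderiv ℝ P z (eb 0)) y (eb α)
              + 2 * fderiv ℝ P y (eb 1) * fderiv ℝ (fun z ↦ fderiv ℝ P z (eb 1)) y (eb α)),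
          2 * (eb α : E4) 0 * fderiv ℝ P y (eb 0) * fderiv ℝ P y (eb 1)
            + 2 * y 0 * (fderiv ℝ (fun z ↦ fderiv ℝ P z (eb 0)) y (eb α) * fderiv ℝ P y (eb 1)
              + fderiv ℝ P y (eb 0) * fderiv ℝ (fun z ↦ fderiv ℝ P z (eb 1)) y (eb α)),
          0, 0],
        ![(eb α : E4) 0 * (fderiv ℝ P y (eb 0) ^ 2 + fderiv ℝ P y (eb 1) ^ 2)
            + y 0 * (2 * fderiv ℝ P y (eb 0) * fderiv ℝ (fun z ↦ fderiv ℝ P z (eb 0)) y (eb α)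
              + 2 * fderiv ℝ P y (eb 1) * fderiv ℝ (fun z ↦ fderiv ℝ P z (eb 1)) y (eb α)),
          2 * (eb α : E4) 0 * fderiv ℝ P y (eb 0) * fderiv ℝ P y (eb 1)
            + 2 * y 0 * (fderiv ℝ (fun z ↦ fderiv ℝ P z (eb 0)) y (eb α) * fderiv ℝ P y (eb 1)
              + fderiv ℝ P y (eb 0) * fderiv ℝ (fun z ↦ fderiv ℝ P z (eb 1)) y (eb α)),
          0, 0],
        ![(eb α : E4) 0 * (fderiv ℝ P y (eb 0) ^ 2 + fderiv ℝ P y (eb 1) ^ 2)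
            + y 0 * (2 * fderiv ℝ P y (eb 0) * fderiv ℝ (fun z ↦ fderiv ℝ P z (eb 0)) y (eb α)
              + 2 * fderiv ℝ P y (eb 1) * fderiv ℝ (fun z ↦ fderiv ℝ P z (eb 1)) y (eb α)),
          2 * (eb α : E4) 0 * fderiv ℝ P y (eb 0) * fderiv ℝ P y (eb 1)
            + 2 * y 0 * (fderiv ℝ (fun z ↦ fderiv ℝ P z (eb 0)) y (eb α) * fderiv ℝ P y (eb 1)
              + fderiv ℝ P y (eb 0) * fderiv ℝ (fun z ↦ fderiv ℝ P z (eb 1)) y (eb α)),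
          0, 0]] α β := by
  -- differentiability of the `P`-partials
  have hPc : ContDiffAt ℝ ∞ (fderiv ℝ P) y :=
    ((h.contDiffOn_P.fderiv_of_isOpen h.isOpen (by simp)) y hy).contDiffAt (h.isOpen.mem_nhds hy)
  have hPd : ∀ v, DifferentiableAt ℝ (fun z ↦ fderiv ℝ P z v) y := fun v ↦
    differentiableAt_clm_apply_const (hPc.differentiableAt (by simp)) v
  have hcoord : DifferentiableAt ℝ (fun z : E4 ↦ z 0) y := (hasFDerivAt_coord 0 y).differentiableAt
  have hc0 : fderiv ℝ (fun z : E4 ↦ z 0) y (eb α) = (eb α : E4) 0 := by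
    rw [(hasFDerivAt_coord 0 y).fderiv]; rfl
  -- the row does not depend on the (spurious) first index of the table
  have hrow : ∀ (r : Fin 4) (x₀ x₁ : ℝ),
      (![![x₀, x₁, 0, 0], ![x₀, x₁, 0, 0], ![x₀, x₁, 0, 0], ![x₀, x₁, 0, 0]] : Fin 4 → Fin 4 → ℝ) r
        = ![x₀, x₁, 0, 0] := by
    intro r x₀ x₁; fin_cases r <;> rfl
  rw [hrow]
  fin_cases β
  · -- `β = 0`: differentiate `λ_t = t (P_t² + P_θ²)`
    simp only [Fin.zero_eta, Fin.isValue, Matrix.cons_val_zero]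
    have heq : (fun z ↦ fderiv ℝ L z (eb 0)) =ᶠ[𝓝 y]
        fun z ↦ z 0 * (fderiv ℝ P z (eb 0) ^ 2 + fderiv ℝ P z (eb 1) ^ 2) := by
      filter_upwards [h.isOpen.mem_nhds hy] with z hz
      exact h.lam_t z hz
    rw [heq.fderiv_eq]
    rw [fderiv_fun_mul hcoord (((hPd _).fun_pow 2).fun_add ((hPd _).fun_pow 2))]
    simp only [_root_.add_apply, FunLike.coe_smul, Pi.smul_apply, smul_eq_mul]
    rw [fderiv_fun_add ((hPd _).fun_pow 2) ((hPd _).fun_pow 2)]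
    simp only [_root_.add_apply]
    rw [fderiv_fun_pow 2 (hPd _), fderiv_fun_pow 2 (hPd _)]
    simp only [FunLike.coe_smul, Pi.smul_apply, smul_eq_mul, hc0]
    ring
  · -- `β = 1`: differentiate `λ_θ = 2 t P_t P_θ`
    simp only [Fin.mk_one, Fin.isValue, Matrix.cons_val_one, Matrix.cons_val_zero]
    have heq : (fun z ↦ fderiv ℝ L z (eb 1)) =ᶠ[𝓝 y]
        fun z ↦ 2 * z 0 * fderiv ℝ P z (eb 0) * fderiv ℝ P z (eb 1) := by
      filter_upwards [h.isOpen.mem_nhds hy] with z hz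
      exact h.lam_θ z hz
    rw [heq.fderiv_eq]
    have h2t : DifferentiableAt ℝ (fun z : E4 ↦ 2 * z 0) y := hcoord.const_mul 2
    rw [fderiv_fun_mul (h2t.fun_mul (hPd _)) (hPd _)]
    simp only [_root_.add_apply, FunLike.coe_smul, Pi.smul_apply, smul_eq_mul]
    rw [fderiv_fun_mul h2t (hPd _)]
    simp only [_root_.add_apply, FunLike.coe_smul, Pi.smul_apply, smul_eq_mul]
    rw [fderiv_const_mul hcoord]
    simp only [FunLike.coe_smul, Pi.smul_apply, smul_eq_mul, hc0]
    ring
  · simp only [Fin.reduceFinMk, Fin.isValue, Matrix.cons_val]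
    exact fderiv_fderiv_L_eq_zero_right h hy 2 (Or.inl rfl) _
  · simp only [Fin.reduceFinMk, Fin.isValue, Matrix.cons_val]
    exact fderiv_fderiv_L_eq_zero_right h hy 3 (Or.inr rfl) _

/-- **Second partials of `a`**: `∂_w ∂_v a = v⁰w⁰/(2t²) + ∂_w∂_v λ /2`. [cite: IsenbergMoncrief1990, (3)] -/
theorem fderiv_fderiv_aF (h : GowdyData V P L) {y : E4} (hy : y ∈ V) (v w : E4) :
    fderiv ℝ (fun z ↦ fderiv ℝ (aF L) z v) y w =
      (1 / 2) * (v 0 * w 0) / (y 0) ^ 2 + fderiv ℝ (fun z ↦ fderiv ℝ L z v) y w / 2 := by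
  have ht : y 0 ≠ 0 := (h.pos y hy).ne'
  have heq : (fun z ↦ fderiv ℝ (aF L) z v) =ᶠ[𝓝 y]
      fun z ↦ (-(1 / 2) * v 0) / z 0 + 2⁻¹ * fderiv ℝ L z v := by
    filter_upwards [h.isOpen.mem_nhds hy] with z hz
    rw [fderiv_aF h hz]; ring
  rw [heq.fderiv_eq]
  have hLc : ContDiffAt ℝ ∞ (fderiv ℝ L) y :=
    ((h.contDiffOn_L.fderiv_of_isOpen h.isOpen (by simp)) y hy).contDiffAt (h.isOpen.mem_nhds hy)
  have hLd : DifferentiableAt ℝ (fun z ↦ fderiv ℝ L z v) y :=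
    differentiableAt_clm_apply_const (hLc.differentiableAt (by simp)) v
  have h1 := hasFDerivAt_const_div_coord ht (-(1 / 2) * v 0)
  rw [fderiv_fun_add h1.differentiableAt (hLd.const_mul _), h1.fderiv]
  simp only [_root_.add_apply, FunLike.coe_smul, Pi.smul_apply, smul_eq_mul]
  rw [fderiv_const_mul hLd]
  simp only [FunLike.coe_smul, Pi.smul_apply, smul_eq_mul]
  have : (EuclideanSpace.proj (0 : Fin 4) : E4 →L[ℝ] ℝ) w = w 0 := rfl
  rw [this]
  field_simp

/-- **Second partials of `b`**: `∂_w ∂_v b = −v⁰w⁰/t² + ∂_w∂_v P`. [cite: IsenbergMoncrief1990, (3)] -/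
theorem fderiv_fderiv_bF (h : GowdyData V P L) {y : E4} (hy : y ∈ V) (v w : E4) :
    fderiv ℝ (fun z ↦ fderiv ℝ (bF P) z v) y w =
      -(v 0 * w 0) / (y 0) ^ 2 + fderiv ℝ (fun z ↦ fderiv ℝ P z v) y w := by
  have ht : y 0 ≠ 0 := (h.pos y hy).ne'
  have heq : (fun z ↦ fderiv ℝ (bF P) z v) =ᶠ[𝓝 y] fun z ↦ v 0 / z 0 + fderiv ℝ P z v := by
    filter_upwards [h.isOpen.mem_nhds hy] with z hz
    rw [fderiv_bF h hz]
  rw [heq.fderiv_eq]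
  have hPc : ContDiffAt ℝ ∞ (fderiv ℝ P) y :=
    ((h.contDiffOn_P.fderiv_of_isOpen h.isOpen (by simp)) y hy).contDiffAt (h.isOpen.mem_nhds hy)
  have hPd : DifferentiableAt ℝ (fun z ↦ fderiv ℝ P z v) y :=
    differentiableAt_clm_apply_const (hPc.differentiableAt (by simp)) v
  have h1 := hasFDerivAt_const_div_coord ht (v 0)
  rw [fderiv_fun_add h1.differentiableAt hPd, h1.fderiv]
  simp only [_root_.add_apply, FunLike.coe_smul, Pi.smul_apply, smul_eq_mul]
  have : (EuclideanSpace.proj (0 : Fin 4) : E4 →L[ℝ] ℝ) w = w 0 := rfl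
  rw [this]
  field_simp

/-- **Second partials of `c`**: `∂_w ∂_v c = −v⁰w⁰/t² − ∂_w∂_v P`. [cite: IsenbergMoncrief1990, (3)] -/
theorem fderiv_fderiv_cF (h : GowdyData V P L) {y : E4} (hy : y ∈ V) (v w : E4) :
    fderiv ℝ (fun z ↦ fderiv ℝ (cF P) z v) y w =
      -(v 0 * w 0) / (y 0) ^ 2 - fderiv ℝ (fun z ↦ fderiv ℝ P z v) y w := by
  have ht : y 0 ≠ 0 := (h.pos y hy).ne'
  have heq : (fun z ↦ fderiv ℝ (cF P) z v) =ᶠ[𝓝 y] fun z ↦ v 0 / z 0 - fderiv ℝ P z v := by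
    filter_upwards [h.isOpen.mem_nhds hy] with z hz
    rw [fderiv_cF h hz]
  rw [heq.fderiv_eq]
  have hPc : ContDiffAt ℝ ∞ (fderiv ℝ P) y :=
    ((h.contDiffOn_P.fderiv_of_isOpen h.isOpen (by simp)) y hy).contDiffAt (h.isOpen.mem_nhds hy)
  have hPd : DifferentiableAt ℝ (fun z ↦ fderiv ℝ P z v) y :=
    differentiableAt_clm_apply_const (hPc.differentiableAt (by simp)) v
  have h1 := hasFDerivAt_const_div_coord ht (v 0)
  rw [fderiv_fun_sub h1.differentiableAt hPd, h1.fderiv]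
  simp only [_root_.sub_apply, FunLike.coe_smul, Pi.smul_apply, smul_eq_mul]
  have : (EuclideanSpace.proj (0 : Fin 4) : E4 →L[ℝ] ℝ) w = w 0 := rfl
  rw [this]
  field_simp

/-- **The table of second partials**: `∂_α ∂_β uᵢ (y) = uSnd …` with `t = y⁰`, `P_t = ∂₀P`,
`P_θ = ∂₁P`, `P_tθ = ∂₀∂₁P`, `P_θθ = ∂₁∂₁P` (the Euler–Poisson–Darboux equation eliminates
`P_tt`, the differentiated Gowdy equations give the `λ`-Hessian). [cite: IsenbergMoncrief1990, (4)–(5)] -/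
theorem fderiv_fderiv_uF_eq (h : GowdyData V P L) {y : E4} (hy : y ∈ V) (i α β : Fin 4) :
    fderiv ℝ (fun z ↦ fderiv ℝ (uF P L i) z (eb β)) y (eb α) =
      uSnd (y 0) (fderiv ℝ P y (eb 0)) (fderiv ℝ P y (eb 1))
        (fderiv ℝ (fun z ↦ fderiv ℝ P z (eb 1)) y (eb 0))
        (fderiv ℝ (fun z ↦ fderiv ℝ P z (eb 1)) y (eb 1)) i α β := by
  have ht : y 0 ≠ 0 := (h.pos y hy).ne'
  -- eliminate `P_tt`
  have hepd : fderiv ℝ (fun z ↦ fderiv ℝ P z (eb 0)) y (eb 0) =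
      fderiv ℝ (fun z ↦ fderiv ℝ P z (eb 1)) y (eb 1) - fderiv ℝ P y (eb 0) / y 0 := by
    have := h.epd y hy; linarith
  have hz := fderiv_fderiv_P_eq_zero h hy
  have h10 := fderiv_fderiv_P_comm h hy
  have hLtab := fderiv_fderiv_L_eq h hy
  fin_cases i
  · -- `u₀ = a`
    simp only [uF, uSnd, Fin.zero_eta, Fin.isValue, Matrix.cons_val_zero]
    rw [fderiv_fderiv_aF h hy, hLtab]
    fin_cases α <;> fin_cases β <;>
      simp [aSnd, hz, h10, Ltt, Ltθ, Lθθ, Ptt, hepd] <;> first | (field_simp; ring) | field_simp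
  · -- `u₁ = a`
    simp only [uF, uSnd, Fin.mk_one, Fin.isValue, Matrix.cons_val_one, Matrix.cons_val_zero]
    rw [fderiv_fderiv_aF h hy, hLtab]
    fin_cases α <;> fin_cases β <;>
      simp [aSnd, hz, h10, Ltt, Ltθ, Lθθ, Ptt, hepd] <;> first | (field_simp; ring) | field_simp
  · -- `u₂ = b`
    simp only [uF, uSnd, Fin.reduceFinMk, Fin.isValue, Matrix.cons_val]
    rw [fderiv_fderiv_bF h hy]
    fin_cases α <;> fin_cases β <;>
      simp [bSnd, hz, h10, Ptt, hepd]
  · -- `u₃ = c`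
    simp only [uF, uSnd, Fin.reduceFinMk, Fin.isValue, Matrix.cons_val]
    rw [fderiv_fderiv_cF h hy]
    fin_cases α <;> fin_cases β <;>
      simp [cSnd, hz, h10, Ptt, hepd]

/-- **Second partials of the components**: `∂_α ∂_β gᵢ = d2 …`
(`= gᵢ (∂_α uᵢ ∂_β uᵢ + ∂_α ∂_β uᵢ)`). [cite: IsenbergMoncrief1990, (3)–(5)] -/
theorem fderiv_fderiv_comp_eq (h : GowdyData V P L) {y : E4} (hy : y ∈ V) (α i β : Fin 4) :
    fderiv ℝ (fun z ↦ fderiv ℝ (comp P L i) z (eb β)) y (eb α) =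
      d2 (y 0) (Real.exp (aF L y)) (Real.exp (bF P y)) (Real.exp (cF P y))
        (fderiv ℝ P y (eb 0)) (fderiv ℝ P y (eb 1))
        (fderiv ℝ (fun z ↦ fderiv ℝ P z (eb 1)) y (eb 0))
        (fderiv ℝ (fun z ↦ fderiv ℝ P z (eb 1)) y (eb 1)) α i β := by
  have hc : comp P L i = fun z ↦ sgn i * Real.exp (uF P L i z) := rfl
  rw [hc, fderiv_fderiv_const_mul_exp h.isOpen hy (contDiffOn_uF h i) (sgn i) (eb β) (eb α),
    fderiv_uF_eq h hy, fderiv_uF_eq h hy, fderiv_fderiv_uF_eq h hy, d2]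
  congr 1
  fin_cases i <;> simp [gval, sgn, uF]

/-! ### Ricci-flatness -/

/-- The values of the components: `gᵢ(y) = gval A B C i` with `A = e^{a(y)}`, `B = e^{b(y)}`,
`C = e^{c(y)}`. [folklore] -/
theorem comp_eq_gval (y : E4) (i : Fin 4) :
    comp P L i y = gval (Real.exp (aF L y)) (Real.exp (bF P y)) (Real.exp (cF P y)) i := by
  fin_cases i <;> simp [comp, gval, sgn, uF]

/-- **The coordinate Ricci form of the polarized Gowdy components vanishes** on all pairs of
coordinate vectors, at every point of `V` (Gowdy 1974, §II; Isenberg–Moncrief 1990: the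
polarized Gowdy equations are the vacuum Einstein equations for this metric form).
[cite: IsenbergMoncrief1990, (3)–(5)] -/
theorem ricAt_comp_eq_zero (h : GowdyData V P L) {y : E4} (hy : y ∈ V) (b c : Fin 4) :
    ricAt (diagMetric (comp P L)) y (eb b) (eb c) = 0 := by
  have hne : ∀ i, ∀ z ∈ V, comp P L i z ≠ 0 := fun i z _ ↦ comp_ne_zero i z
  rw [ricAt_diagMetric_eb h.isOpen (contDiffOn_comp h) hne hy]
  simp only [fderiv_comp_eq h hy, fderiv_fderiv_comp_eq h hy, comp_eq_gval]
  exact ricci_core (y 0) _ _ _ _ _ _ _ (h.pos y hy).ne' (Real.exp_pos _).ne'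
    (Real.exp_pos _).ne' (Real.exp_pos _).ne' b c

/-- **The polarized Gowdy spacetime metric** on a chart domain `V : Opens E4` carrying Gowdy data:
the Lorentzian metric of the components `Gowdy.comp` (`OpensChart.diagLorentz`).
[cite: IsenbergMoncrief1990, (3)] -/
abbrev metric (V : Opens E4) (P L : E4 → ℝ) (h : GowdyData (V : Set E4) P L) :
    LorentzianMetric 𝓘(ℝ, E4) ∞ V :=
  OpensChart.diagLorentz V (comp P L) (contDiffOn_comp h) (fun y _ ↦ comp_zero_neg y)
    (fun i y _ ↦ comp_succ_pos i y)

/-- The value of the Gowdy metric is the diagonal form of `Gowdy.comp`. [folklore] -/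
@[simp]
theorem metric_val (V : Opens E4) (P L : E4 → ℝ) (h : GowdyData (V : Set E4) P L) (y : V) :
    (metric V P L h).val y = diagMetric (comp P L) y.1 := rfl

/-- **Polarized Gowdy metrics are Ricci-flat** (vacuum): `Ric(g) = 0` for the metric of
`Gowdy.metric` (Gowdy 1974, §II; Isenberg–Moncrief 1990, (3)–(5); Ringström 2009, §24.1).
[cite: IsenbergMoncrief1990, (3)–(5)] -/
theorem isRicciFlat (V : Opens E4) (P L : E4 → ℝ) (h : GowdyData (V : Set E4) P L)
    [(metric V P L h).toPseudoRiemannianMetric.HasLeviCivita] :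
    (metric V P L h).toPseudoRiemannianMetric.IsRicciFlat :=
  OpensChart.isRicciFlat_diagLorentz_of_ricAt_eb fun y b c ↦ ricAt_comp_eq_zero h y.2 b c

end Gowdy

end Literature.Geometry.Lorentzian
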